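import Literature.NumberTheory.Automorphic.GKModulesSmoothVectorsProofs
import Literature.NumberTheory.Automorphic.GKCohomology
import HarnessLib

/-!
# FLOOR-0 P3 — rung-1 support: a CRITERION FOR SMOOTH VECTORS from directional `L²`-derivatives, and the
# `𝔨`-equivariance of a `K`-equivariant value map (generic linear real group)

Cell hodgecm-mathlib, FLOOR 0, crux item H413 = stmt-HodgeConjecture-24833; brief B1′ of the P3 integrator (F0P3-plan (g0)
2026-08-31T00:17:32Z, «the value-map adapter»), author F0P3-p01 (g3).  PROOF lane (no `def`, no instance, no named fact).
GENERIC over a linear real group `G : RealMatrixGroup A N` (★ `RealMatrixGroups`); consumed by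
`Theorems/F0P3CotangentFormValueMap.lean` at `G = U(2,1)_{Fin 2 ⊕ Fin 1}`.

* §1 `hasFDerivAt_orbit_of_hasDerivAt_smul` — for a strongly continuous representation `σ` of `G` on a Banach space
  `E`, if the one-parameter orbits `t ↦ σ(exp tY) w` have derivatives `δ Y` at `t = 0` for EVERY `Y ∈ 𝔤`, with `δ`
  (real-)LINEAR in `Y`, then the orbit map `Y ↦ σ(exp Y) w` is Fréchet-differentiable at `0` with derivative `δ`
  (mean value inequality along the segment `t ↦ tY`; the directional derivative at time `t` is `σ(exp tY) (δ Y)` and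
  `σ(exp tY) → 1` strongly, uniformly on the finitely many `δ(basis vectors)`).  Harish-Chandra 1953, §9; Wallach
  §1.6.1–1.6.2.
* §2 `contDiff_orbit_of_mem_stable` — a set `S ⊆ E` such that every `w ∈ S` has an orbit map differentiable at `0`
  with derivative `D w` taking values in `S` consists of SMOOTH vectors: `Y ↦ σ(exp Y) w` is `C^∞` for `w ∈ S`
  (induction on the order with ★ `ExpOrbit.hasFDerivAt_orbit` ∕ `ExpOrbit.contDiff_candidate`).  Harish-Chandra 1953,
  §9 (p. 225: the Gårding-type argument «`π(X) ψ` again well-behaved»).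
* §3 the `ContRepresentation` forms `mem_smoothVectors_of_forall_hasDerivAt` (★ `smoothVectors`) and
  `dπ_eq_of_hasDerivAt` (★ `dπ` is the prescribed derivative, by uniqueness of limits).
* §4 `lie_apply_eq_of_K_equivariant` — for ANY `(𝔤, K)`-module `(ρK, ρ𝔤)` (★ `IsGKModule`) and any real-linear
  `φ : 𝔤 → V` with `ρK(k) φ(X) = φ(Ad(k) X)`, also `φ(⁅W, X⁆) = ρ𝔤(W) φ(X)` for `W ∈ 𝔨` (differentiate the
  `K`-equivariance along `exp tW` weakly — the `hasWeakDeriv` axiom — and separate points by linear functionals).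
  Borel–Wallach 2000, I §5.1; Knapp–Vogan 1995, (1.64)–(1.65).

References: Harish-Chandra, *Representations of a semisimple Lie group on a Banach space. I*, Trans. AMS 75 (1953), §7, §9
[HarishChandra1953]; N. R. Wallach, *Real Reductive Groups I* (1988), §1.6.1–1.6.2, §3.3.1 [WallachRRG1]; A. Borel, N. Wallach,
*Continuous cohomology, discrete subgroups, and representations of reductive groups* (2000), I §5.1 [BorelWallach2000].
HONEST LABEL: HC_CM is proved only modulo the printed citations until rung 0 closes; this file discharges none of them.
-/

-- Mathlib idiom (Mathlib/Algebra/Lie/OfAssociative.lean; as in ★ `GKModules` and every `(𝔤, K)` file of the tree):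
-- the commutator bracket on `Matrix N N A` and on `Module.End ℂ V`, needed to MENTION `G.lie →ₗ⁅ℝ⁆ Module.End ℂ _`.
attribute [local instance 100] LieRing.ofAssociativeRing

-- The scoped `L^∞`-operator normed structure on `Matrix N N A` agrees with the product topology only up to non-reducible
-- unfolding (cf. `Matrix.exp_add_of_commute` in Mathlib and ★ `GKModulesSmoothVectorsProofs`).
set_option backward.isDefEq.respectTransparency false

set_option autoImplicit false
set_option linter.dupNamespace false

open scoped MatrixGroups Matrix ContDiff Topology
open NormedSpace Filter

noncomputable section

namespace Summit.HodgeConjecture.HodgeConjecture.Cruxes.H413.F0P3OrbitSmoothVectors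

open Literature.NumberTheory.Automorphic Literature.NumberTheory.Automorphic.ExpOrbit
open scoped Matrix.Norms.Operator

variable {A : Type*} [NormedCommRing A] [NormedAlgebra ℝ A] [NormedAlgebra ℚ A] [CompleteSpace A]
  [StarRing A] {N : Type*} [Fintype N] [DecidableEq N] (G : RealMatrixGroup A N)

/-! ## §1 From directional derivatives, linear in the direction, to the Fréchet derivative at `0` -/

section Orbit

variable {E : Type*} [NormedAddCommGroup E] [NormedSpace ℝ E] (σ : G.carrier →* (E →L[ℝ] E))

/-- Along a one-parameter group, a derivative at `t = 0` propagates: if `t ↦ σ(exp tY) w` has derivative `d` at `0`,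
it has derivative `σ(exp sY) d` at every `s`. [cite: WallachRRG1, §1.6.1] -/
theorem hasDerivAt_orbit_smul_of_hasDerivAt_zero {w d : E} {Y : G.lie.toSubmodule}
    (h : HasDerivAt (fun t : ℝ => orbit G σ w (t • Y)) d 0) (s : ℝ) :
    HasDerivAt (fun t : ℝ => orbit G σ w (t • Y)) (σ (G.expS (s • Y)) d) s := by
  have h0 : HasDerivAt (fun t : ℝ => orbit G σ w (t • Y)) d (s - s) := by rwa [sub_self]
  have h1 : HasDerivAt (fun t : ℝ => orbit G σ w ((t - s) • Y)) d s := by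
    have := h0.comp_sub_const s s
    simpa using this
  have h2 := (σ (G.expS (s • Y))).hasFDerivAt.comp_hasDerivAt s h1
  refine h2.congr_of_eventuallyEq (Eventually.of_forall fun t => ?_)
  show orbit G σ w (t • Y) = σ (G.expS (s • Y)) (orbit G σ w ((t - s) • Y))
  rw [← orbit_add_smul, add_sub_cancel]

variable [FiniteDimensional ℝ A]

/-- **Directional derivatives, linear in the direction, give the Fréchet derivative at `0`.**  For a strongly
continuous representation `σ` of the linear real group `G` on a Banach space and `w ∈ E`: if for every `Y ∈ 𝔤` the
orbit `t ↦ σ(exp tY) w` has derivative `δ Y` at `t = 0`, where `δ : 𝔤 →L[ℝ] E` is (continuous) linear, then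
`Y ↦ σ(exp Y) w` has Fréchet derivative `δ` at `0`.  [cite: HarishChandra1953, §9 (p. 225)] [cite: WallachRRG1, §1.6.1] -/
theorem hasFDerivAt_orbit_of_hasDerivAt_smul (hσ : ∀ v, Continuous fun g : G.carrier => σ g v) {w : E}
    (δ : G.lie.toSubmodule →L[ℝ] E)
    (hδ : ∀ Y : G.lie.toSubmodule, HasDerivAt (fun t : ℝ => orbit G σ w (t • Y)) (δ Y) 0) :
    HasFDerivAt (orbit G σ w) δ 0 := by
  -- the finitely many vectors `δ (basis j)` and the continuous maps `Z ↦ σ(exp Z) (δ b_j) - δ b_j`, vanishing at `0`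
  set d : ℕ := Module.finrank ℝ G.lie.toSubmodule
  have hF : ∀ j : Fin d, Continuous fun Z : G.lie.toSubmodule => orbit G σ (δ (basisS G j)) Z - δ (basisS G j) :=
    fun j => (continuous_orbit G σ hσ _).sub continuous_const
  set C : ℝ := ∑ j : Fin d, ‖coordS G j‖ with hC
  have hC0 : 0 ≤ C := Finset.sum_nonneg fun j _ => ContinuousLinearMap.opNorm_nonneg (coordS G j)
  rw [hasFDerivAt_iff_isLittleO_nhds_zero, Asymptotics.isLittleO_iff]
  intro ε hε
  -- uniform smallness of `σ(exp Z) (δ b_j) - δ b_j` near `Z = 0`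
  set ε' : ℝ := ε / (C + 1) with hε'
  have hε'0 : 0 < ε' := div_pos hε (by linarith)
  have hnhds : ∀ᶠ Z in 𝓝 (0 : G.lie.toSubmodule),
      ∀ j : Fin d, ‖orbit G σ (δ (basisS G j)) Z - δ (basisS G j)‖ < ε' := by
    refine Filter.eventually_all.2 fun j => ?_
    have h0 : orbit G σ (δ (basisS G j)) 0 - δ (basisS G j) = 0 := by rw [orbit_zero, sub_self]
    have := ((hF j).tendsto 0).eventually (Metric.ball_mem_nhds _ hε'0)
    rw [h0] at this
    filter_upwards [this] with Z hZ
    simpa using hZ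
  obtain ⟨r, hr, hrε⟩ := Metric.eventually_nhds_iff.1 hnhds
  filter_upwards [Metric.ball_mem_nhds (0 : G.lie.toSubmodule) hr] with Y hY
  have hY' : ‖Y‖ < r := by simpa using hY
  -- the derivative of `g(t) = σ(exp tY) w - t • δ Y` on `[0,1]` is `σ(exp tY) (δ Y) - δ Y`, of norm `≤ ε ‖Y‖`
  have hderiv : ∀ t : ℝ,
      HasDerivAt (fun u : ℝ => orbit G σ w (u • Y) - u • δ Y) (σ (G.expS (t • Y)) (δ Y) - δ Y) t := by
    intro t
    have h1 := hasDerivAt_orbit_smul_of_hasDerivAt_zero G σ (hδ Y) t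
    have h2 : HasDerivAt (fun u : ℝ => u • δ Y) (δ Y) t := by
      simpa using (hasDerivAt_id t).smul_const (δ Y)
    exact h1.sub h2
  have hbound : ∀ t ∈ Set.Ico (0 : ℝ) 1, ‖σ (G.expS (t • Y)) (δ Y) - δ Y‖ ≤ ε * ‖Y‖ := by
    intro t ht
    -- expand `δ Y` along the basis
    have hδY : δ Y = ∑ j : Fin d, (coordS G j Y) • δ (basisS G j) := by
      have e := congrArg (fun T : G.lie.toSubmodule →L[ℝ] E => T Y) (clm_eq_sum_smulRight G δ)
      simpa only [_root_.sum_apply, ContinuousLinearMap.smulRight_apply] using e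
    have htY : ‖t • Y‖ < r := by
      rw [norm_smul, Real.norm_eq_abs, abs_of_nonneg ht.1]
      exact (mul_le_of_le_one_left (norm_nonneg _) ht.2.le).trans_lt hY'
    have hj : ∀ j : Fin d, ‖orbit G σ (δ (basisS G j)) (t • Y) - δ (basisS G j)‖ < ε' :=
      hrε (by simpa [dist_eq_norm] using htY)
    calc ‖σ (G.expS (t • Y)) (δ Y) - δ Y‖
        = ‖∑ j : Fin d, (coordS G j Y) • (orbit G σ (δ (basisS G j)) (t • Y) - δ (basisS G j))‖ := by
          rw [hδY, map_sum, ← Finset.sum_sub_distrib]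
          congr 1
          refine Finset.sum_congr rfl fun j _ => ?_
          rw [map_smul, orbit_apply, smul_sub]
      _ ≤ ∑ j : Fin d, ‖(coordS G j Y) • (orbit G σ (δ (basisS G j)) (t • Y) - δ (basisS G j))‖ :=
          norm_sum_le _ _
      _ ≤ ∑ j : Fin d, ‖coordS G j‖ * ‖Y‖ * ε' := by
          refine Finset.sum_le_sum fun j _ => ?_
          rw [norm_smul]
          exact mul_le_mul (ContinuousLinearMap.le_opNorm _ _) (hj j).le (norm_nonneg _)
            (mul_nonneg (ContinuousLinearMap.opNorm_nonneg _) (norm_nonneg _))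
      _ = C * ε' * ‖Y‖ := by
          rw [hC, Finset.sum_mul, Finset.sum_mul]
          exact Finset.sum_congr rfl fun j _ => by ring
      _ ≤ ε * ‖Y‖ := by
          refine mul_le_mul_of_nonneg_right ?_ (norm_nonneg _)
          rw [hε', mul_div_assoc', div_le_iff₀ (by linarith)]
          nlinarith
  have hMVI := norm_image_sub_le_of_norm_deriv_le_segment_01'
    (f := fun u : ℝ => orbit G σ w (u • Y) - u • δ Y)
    (fun t _ => (hderiv t).hasDerivWithinAt) hbound
  simp only [one_smul, zero_smul, orbit_zero, sub_zero] at hMVI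
  calc ‖orbit G σ w (0 + Y) - orbit G σ w 0 - δ Y‖ = ‖orbit G σ w Y - δ Y - w‖ := by
        rw [zero_add, orbit_zero]; congr 1; abel
    _ ≤ ε * ‖Y‖ := hMVI

/-! ## §2 A stable set of differentiable vectors consists of smooth vectors -/

variable [CompleteSpace E]

/-- **A set of vectors, stable under the differentials of its members' orbit maps at `0`, consists of smooth vectors.**
If every `w ∈ S` has `Y ↦ σ(exp Y) w` Fréchet-differentiable at `0` with derivative `D w`, and `D w Y ∈ S` for all
`Y ∈ 𝔤`, then `Y ↦ σ(exp Y) w` is `C^∞` on `𝔤` for every `w ∈ S` (by induction on the order: the derivative at `Y` is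
`σ(exp Y) ∘ D w ∘ L(Y)`, ★ `ExpOrbit.hasFDerivAt_orbit`, which is `C^k` as soon as the orbits of the finitely many
`D w (b_j)` are, ★ `ExpOrbit.contDiff_candidate`). [cite: HarishChandra1953, §9 (p. 225)] [cite: WallachRRG1, §1.6.2] -/
theorem contDiff_orbit_of_mem_stable (hσ : ∀ v, Continuous fun g : G.carrier => σ g v) {S : Set E}
    (D : E → (G.lie.toSubmodule →L[ℝ] E)) (hD : ∀ w ∈ S, HasFDerivAt (orbit G σ w) (D w) 0)
    (hS : ∀ w ∈ S, ∀ Y : G.lie.toSubmodule, D w Y ∈ S) {w : E} (hw : w ∈ S) :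
    ContDiff ℝ ∞ (orbit G σ w) := by
  suffices h : ∀ (k : ℕ), ∀ w ∈ S, ContDiff ℝ (k : WithTop ℕ∞) (orbit G σ w) by
    rw [contDiff_infty]
    exact fun k => h k w hw
  intro k
  induction k with
  | zero =>
    intro w _
    rw [Nat.cast_zero]
    exact contDiff_zero.2 (continuous_orbit G σ hσ w)
  | succ k ih =>
    intro w hw
    rw [Nat.cast_succ, contDiff_succ_iff_hasFDerivAt]
    exact ⟨fun Y => (σ (G.expS Y)).comp ((D w).comp (G.dexpInt Y)),
      contDiff_candidate G σ (mod_cast le_top) (D w) fun j => ih _ (hS w hw _),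
      fun Y => hasFDerivAt_orbit G σ hσ (hD w hw) Y⟩

/-- The two steps combined: **directional derivatives at `0`, linear in the direction and staying in `S`, make `S` a set of
smooth vectors.** [cite: HarishChandra1953, §9 (p. 225)] -/
theorem contDiff_orbit_of_hasDerivAt_smul_mem (hσ : ∀ v, Continuous fun g : G.carrier => σ g v) {S : Set E}
    (D : E → (G.lie.toSubmodule →L[ℝ] E))
    (hD : ∀ w ∈ S, ∀ Y : G.lie.toSubmodule, HasDerivAt (fun t : ℝ => orbit G σ w (t • Y)) (D w Y) 0)
    (hS : ∀ w ∈ S, ∀ Y : G.lie.toSubmodule, D w Y ∈ S) {w : E} (hw : w ∈ S) :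
    ContDiff ℝ ∞ (orbit G σ w) :=
  contDiff_orbit_of_mem_stable G σ hσ D
    (fun w hw => hasFDerivAt_orbit_of_hasDerivAt_smul G σ hσ (D w) (hD w hw)) hS hw

end Orbit

/-! ## §3 The same for a continuous representation on a complex Banach space: membership in `smoothVectors`, and `dπ` -/

section Smooth

variable {H : Type*} [NormedAddCommGroup H] [NormedSpace ℂ H] [CompleteSpace H] [FiniteDimensional ℝ A]
  (π : ContRepresentation ℂ G.carrier H)

/-- A real-linear map out of `𝔤` (finite-dimensional), read on the normed copy `G.lie.toSubmodule` of `𝔤`, is a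
CONTINUOUS linear map. [folklore] -/
theorem exists_clm_eq {F : Type*} [NormedAddCommGroup F] [NormedSpace ℝ F] (D : G.lie →ₗ[ℝ] F) :
    ∃ δ : G.lie.toSubmodule →L[ℝ] F, ∀ Y : G.lie.toSubmodule, δ Y = D ⟨Y, Y.2⟩ := by
  let D' : G.lie.toSubmodule →ₗ[ℝ] F :=
    { toFun := fun Y => D ⟨Y, Y.2⟩
      map_add' := fun Y Z => by rw [← map_add]; rfl
      map_smul' := fun c Y => by rw [RingHom.id_apply, ← map_smul]; rfl }
  exact ⟨LinearMap.toContinuousLinearMap D', fun Y => rfl⟩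

/-- **Smooth vectors from directional derivatives.**  Let `π` be a strongly continuous representation of `G` on a complex
Banach space `H` and `S ⊆ H`.  Suppose every `v ∈ S` has, for every `X ∈ 𝔤`, a derivative `D v X` of `t ↦ π(exp tX) v` at
`t = 0`, with `D v : 𝔤 → H` real-linear and `D v X ∈ S`.  Then `S ⊆ H^∞` (★ `smoothVectors`).
[cite: HarishChandra1953, §9 (p. 225)] [cite: WallachRRG1, §1.6.2] -/
theorem mem_smoothVectors_of_forall_hasDerivAt (hπ : π.IsStronglyContinuous) {S : Set H}
    (D : H → (G.lie →ₗ[ℝ] H))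
    (hD : ∀ v ∈ S, ∀ X : G.lie, HasDerivAt (fun t : ℝ => π (G.expMem (t • X)) v) (D v X) 0)
    (hS : ∀ v ∈ S, ∀ X : G.lie, D v X ∈ S) {v : H} (hv : v ∈ S) :
    v ∈ smoothVectors G π := by
  choose δ hδ using fun w : H => exists_clm_eq G (D w)
  rw [mem_smoothVectors_iff_contDiff_orbit]
  refine contDiff_orbit_of_hasDerivAt_smul_mem G (realRep G π) (continuous_realRep_apply G π hπ) (S := S) δ
    (fun w hw Y => ?_) (fun w hw Y => by rw [hδ]; exact hS w hw _) hv
  rw [hδ]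
  exact hD w hw ⟨Y, Y.2⟩

omit [CompleteSpace H] [FiniteDimensional ℝ A] in
/-- **`dπ` is the prescribed derivative**: for a smooth vector `v`, if `t ↦ π(exp tX) v` has derivative `w` at `0` then
`dπ(X) v = w` (uniqueness of the derivative; ★ `hasDerivAt_dπ`). [cite: HarishChandra1953, §7 (p. 209)] -/
theorem dπ_eq_of_hasDerivAt {v : H} (hv : v ∈ smoothVectors G π) {X : G.lie} {w : H}
    (h : HasDerivAt (fun t : ℝ => π (G.expMem (t • X)) v) w 0) : dπ G π v X = w :=
  (hasDerivAt_dπ G π (differentiableAt_of_mem_smoothVectors G π hv) X).unique h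

end Smooth

/-! ## §4 `K`-equivariant value maps are `𝔨`-equivariant (any `(𝔤, K)`-module) -/

section KEquivariant

variable [FiniteDimensional ℝ A]

/-- `t ↦ ψ (Ad(exp tW) X)` has derivative `ψ ⁅W, X⁆` at `t = 0`, for a real-linear `ψ : 𝔤 → F` into a normed space
(★ `hasDerivAt_AdCLM_expS_smul`, pushed along `ψ`). [cite: WallachRRG1, §1.6.1] -/
theorem hasDerivAt_apply_Ad_expMem {F : Type*} [NormedAddCommGroup F] [NormedSpace ℝ F] (ψ : G.lie →ₗ[ℝ] F)
    (W X : G.lie) :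
    HasDerivAt (fun t : ℝ => ψ (G.Ad (G.expMem (t • W)) X)) (ψ ⁅W, X⁆) 0 := by
  obtain ⟨δ, hδ⟩ := exists_clm_eq G (F := F) ψ
  have h := δ.hasFDerivAt.comp_hasDerivAt 0 (G.hasDerivAt_AdCLM_expS_smul ⟨W, W.2⟩ ⟨X, X.2⟩)
  have e1 : (δ ∘ fun t : ℝ => G.AdCLM (G.expS (t • (⟨W, W.2⟩ : G.lie.toSubmodule))) ⟨X, X.2⟩) =
      fun t : ℝ => ψ (G.Ad (G.expMem (t • W)) X) := by
    funext t
    rw [Function.comp_apply, hδ]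
    rfl
  have e2 : δ (G.brS ⟨W, W.2⟩ ⟨X, X.2⟩) = ψ ⁅W, X⁆ := by
    rw [hδ]
    rfl
  rwa [e1, e2] at h

variable [StarModule ℝ A] [ContinuousStar A]
  {V : Type*} [AddCommGroup V] [Module ℂ V]
  {ρK : Representation ℂ G.maximalCompact V} {ρ𝔤 : G.lie →ₗ⁅ℝ⁆ Module.End ℂ V}

/-- **A `K`-equivariant real-linear map `φ : 𝔤 → V` into a `(𝔤, K)`-module is `𝔨`-equivariant**:
`ρK(k) φ(X) = φ(Ad(k) X)` for all `k ∈ K` implies `φ(⁅W, X⁆) = ρ𝔤(W) φ(X)` for all `W ∈ 𝔨` — differentiate the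
hypothesis along `k = exp tW` against every linear functional (the weak-derivative axiom `IsGKModule.hasWeakDeriv`) and
separate points.  This is the passage from the group-level condition (1.64) to the Lie-algebra condition (1.65) of
Knapp–Vogan for value maps. [cite: BorelWallach2000, I §5.1] [cite: WallachRRG1, §3.3.1] -/
theorem lie_apply_eq_of_K_equivariant (hGK : IsGKModule G ρK ρ𝔤) (φ : G.lie →ₗ[ℝ] V)
    (hK : ∀ (k : G.maximalCompact) (X : G.lie),
      ρK k (φ X) = φ (G.Ad (Subgroup.inclusion G.maximalCompact_le_carrier k) X)) :
    ∀ W ∈ G.kInLie, ∀ X : G.lie, φ ⁅W, X⁆ = ρ𝔤 W (φ X) := by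
  intro W hW X
  obtain ⟨W', rfl⟩ := hW
  -- every linear functional agrees on the two sides
  rw [← sub_eq_zero, ← Module.forall_dual_apply_eq_zero_iff ℂ]
  intro ℓ
  rw [map_sub, sub_eq_zero]
  have h1 := hGK.hasWeakDeriv W' (φ X) ℓ
  -- the same function, rewritten through `K`-equivariance, has derivative `ℓ (φ ⁅W, X⁆)`
  have hfun : (fun t : ℝ => ℓ (ρK (G.expK (t • W')) (φ X))) =
      fun t : ℝ => ℓ (φ (G.Ad (G.expMem (t • LieSubalgebra.inclusion G.compactLie_le_lie W')) X)) := by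
    funext t
    rw [hK]
    rfl
  have h2 : HasDerivAt
      (fun t : ℝ => ℓ (φ (G.Ad (G.expMem (t • LieSubalgebra.inclusion G.compactLie_le_lie W')) X)))
      (ℓ (φ ⁅LieSubalgebra.inclusion G.compactLie_le_lie W', X⁆)) 0 :=
    hasDerivAt_apply_Ad_expMem G (F := ℂ) ((ℓ.restrictScalars ℝ).comp φ)
      (LieSubalgebra.inclusion G.compactLie_le_lie W') X
  rw [hfun] at h1
  exact h2.unique h1

end KEquivariant

end Summit.HodgeConjecture.HodgeConjecture.Cruxes.H413.F0P3OrbitSmoothVectors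

end
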